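import Summits.BirchSwinnertonDyer.BirchSwinnertonDyer.Theorems.ManinLocalTwoThreeShimuraTwoCharOfPeriods
import HarnessLib

/-!
# The Shimura character PINNED at the cyclic levels: `Λ₁(f) = Λ₀(f)`, or the `Γ₁(N)`-periods are exactly the periods of the
# `γ ∈ Γ₀(N)` with `(p | d_γ) = +1` (`N = 4p, 8p, 16p`) resp. `(2 | d_γ) = +1`, i.e. `d_γ ≡ ±1 (mod 8)` (`N = 32, 64, 128, 256`)
Summit `BirchSwinnertonDyer`, route `ManinLocalTwoThree` (cell bsd-f2-manin), deciding crux C2 `ManinOddAtFour` (stmt-BirchSwinnertonDyer-22967);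
lead p1 gen 15.  By-name corollaries of `…ShimuraTwoCharOfPeriods.exists_jacobiSym_represents_of_generator_mod_of_isNewform0` (the period class
of a newform at a cyclic level is an admissible Kronecker symbol `(q | ·)`, `q ∣ N` squarefree, odd unless `32 ∣ N`, `≡ 1 (mod 4)` unless
`8 ∣ N`) by exhausting the admissible `q`: for a NEWFORM `f ∈ S₂(Γ₀(N))` (no optimality, no curve):
* `periodLatticeGamma1_eq_of_forall_jacobiSym_one` — if the representing symbol is `(1 | ·)`, `Λ₁(f) = Λ₀(f)`;
* **`periodLatticeGamma1_eq_or_legendre_of_four_mul_prime`** — `N = 4p`, `p` odd prime: `Λ₁(f) = Λ₀(f)`, OR `p ≡ 1 (mod 4)` and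
  `{∞, γ∞}_f ∈ Λ₁(f) ⟺ (p | |d_γ|) = 1` (so at `p ≡ 3 (mod 4)`: `Λ₁ = Λ₀`, a second proof of `…LevelInstances.periodLatticeGamma1_eq_of_four_mul_prime`);
* **`periodLatticeGamma1_eq_or_legendre_of_eight_mul_prime`**, **`…_sixteen_mul_prime`** — `N = 8p, 16p`: `Λ₁ = Λ₀` or `{∞, γ∞}_f ∈ Λ₁ ⟺ (p | |d_γ|) = 1`;
* **`periodLatticeGamma1_eq_or_chi8_of_two_power`** — `N ∈ {32, 64, 128, 256}`: `Λ₁ = Λ₀` or `{∞, γ∞}_f ∈ Λ₁ ⟺ (2 | |d_γ|) = 1`.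
es census E15 (the 49 index-`2` classes at `4 ∣ N`, HOME/p1/g15/CENSUS-shimura-levels-p1-g15.md): `q = p` at `20, 40, 52, 80, 116, 208, 212, …`, `q = 2` at
`64, 128`, `q = 3` at `24, 48` — as the theorems dictate.  HONEST FRAMING: structure theorems about newform period lattices; which alternative
holds is NOT decided; C2, Manin's conjecture and BSD are not proved.  No definitions, no sorry.
[cite: LingOesterle1991, §1, Thm. 1 and Thm. 6] [cite: Stevens1989, §2]
-/

set_option autoImplicit false
-- the summit-side namespace `Summit.BirchSwinnertonDyer.BirchSwinnertonDyer.…` is the tree's (summit = sub-problem)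
set_option linter.dupNamespace false

noncomputable section

open scoped MatrixGroups ModularForm NumberTheorySymbols

open CongruenceSubgroup Literature.NumberTheory.EllipticCurves
  Literature.NumberTheory.EllipticCurves.ModularForms

namespace Summit.BirchSwinnertonDyer.BirchSwinnertonDyer.Theorems.ManinLocalTwoThree

variable {N : ℕ} [NeZero N] (f : CuspForm (Gamma0 N) 2)

/-- If the trivial symbol `(1 | ·)` represents the period class, then `Λ₁(f) = Λ₀(f)` (every period is a cusp symbol,
`coe_periodLattice_eq_range`). [cite: Manin1972, Prop. 1.4 / Thm. 1.6] -/
theorem periodLatticeGamma1_eq_of_forall_jacobiSym_one {q : ℕ} (hq : q = 1)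
    (h : ∀ γ : Gamma0 N, cuspSymbol f γ ∈ periodLatticeGamma1 f ↔ J(q | (((γ : SL(2, ℤ)) 1 1 : ℤ)).natAbs) = 1) :
    periodLatticeGamma1 f = periodLattice f := by
  subst hq
  refine le_antisymm (periodLatticeGamma1_le_periodLattice f) fun z hz ↦ ?_
  have hz' : z ∈ (periodLattice f : Set ℂ) := hz
  rw [coe_periodLattice_eq_range] at hz'
  obtain ⟨γ, rfl⟩ := hz'
  exact (h γ).mpr (jacobiSym.one_left _)

/-- An odd divisor of `2^a · p` (`p` prime) is `1` or `p`. [folklore] -/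
theorem eq_one_or_eq_of_dvd_two_pow_mul_prime {q a p : ℕ} (hp : p.Prime) (hq : q ∣ 2 ^ a * p) (hodd : Odd q) :
    q = 1 ∨ q = p := by
  have h2 : Nat.Coprime q (2 ^ a) := (Nat.coprime_two_right.mpr hodd).pow_right a
  have hqp : q ∣ p := h2.dvd_of_dvd_mul_left hq
  exact (Nat.dvd_prime hp).mp hqp

/-- A squarefree divisor of `2^e` is `1` or `2`. [folklore] -/
theorem eq_one_or_eq_two_of_squarefree_dvd_two_pow {q e : ℕ} (hq : q ∣ 2 ^ e) (hsq : Squarefree q) : q = 1 ∨ q = 2 := by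
  obtain ⟨k, -, rfl⟩ := (Nat.dvd_prime_pow Nat.prime_two).mp hq
  rcases k with _ | k
  · left; rfl
  · rcases k with _ | k
    · right; rfl
    · exfalso
      have h4 : 2 * 2 ∣ 2 ^ (k + 2) := ⟨2 ^ k, by ring⟩
      have hu := hsq 2 h4
      norm_num at hu

/-- **`N = 2^a·p` with `8 ∣ N` or `p ≡ 1 (mod 4)`-filter, newform, cyclic level data ⟹ `Λ₁ = Λ₀` or the class is `(p | ·)`.**  Internal engine:
from an admissible `q` at a level `2^a p` (`a ≤ 4`, so `32 ∤ N` and `q` is odd) conclude `q ∈ {1, p}`. -/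
theorem periodLatticeGamma1_eq_or_legendre_of_admissible {a p : ℕ} (hp : p.Prime) (hN : N = 2 ^ a * p) (ha : a ≤ 4) (hp2 : p ≠ 2)
    {q : ℕ} (hqN : q ∣ N) (h32 : ¬ 32 ∣ N → Odd q)
    (h : ∀ γ : Gamma0 N, cuspSymbol f γ ∈ periodLatticeGamma1 f ↔ J(q | (((γ : SL(2, ℤ)) 1 1 : ℤ)).natAbs) = 1) :
    periodLatticeGamma1 f = periodLattice f ∨
      (q = p ∧ ∀ γ : Gamma0 N, cuspSymbol f γ ∈ periodLatticeGamma1 f ↔ J(p | (((γ : SL(2, ℤ)) 1 1 : ℤ)).natAbs) = 1) := by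
  have h32' : ¬ 32 ∣ N := by
    rw [hN]; intro h32d
    have hcop : Nat.Coprime (2 ^ 5) p := (Nat.coprime_primes Nat.prime_two hp |>.mpr (Ne.symm hp2)).pow_left 5
    have h' : 2 ^ 5 ∣ 2 ^ a := hcop.dvd_of_dvd_mul_right (by simpa using h32d)
    have := Nat.pow_dvd_pow_iff_le_right (by norm_num : 1 < 2) |>.mp h'
    omega
  rcases eq_one_or_eq_of_dvd_two_pow_mul_prime hp (hN ▸ hqN) (h32 h32') with rfl | rfl
  · exact Or.inl (periodLatticeGamma1_eq_of_forall_jacobiSym_one f rfl h)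
  · exact Or.inr ⟨rfl, h⟩

/-- **`N = 4p`, `p` an odd prime, `f` a newform: `Λ₁(f) = Λ₀(f)`, OR `p ≡ 1 (mod 4)` and the `Γ₁(4p)`-periods are exactly the periods
of the `γ` with `(p | |d_γ|) = +1`.**  (`u = 2`, `v = p`, units of `ℤ/2p` cyclic; admissible `q ∈ {1, p}` with `q ≡ 1 (mod 4)`.)
[cite: LingOesterle1991, §1, Thm. 1 and Thm. 6] [cite: Stevens1989, §2] -/
theorem periodLatticeGamma1_eq_or_legendre_of_four_mul_prime {p : ℕ} (hp : p.Prime) (hp2 : p ≠ 2) (hN : N = 4 * p)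
    (hf : IsNewform0 f) :
    periodLatticeGamma1 f = periodLattice f ∨
      (p % 4 = 1 ∧ ∀ γ : Gamma0 N, cuspSymbol f γ ∈ periodLatticeGamma1 f ↔ J(p | (((γ : SL(2, ℤ)) 1 1 : ℤ)).natAbs) = 1) := by
  haveI : Fact p.Prime := ⟨hp⟩
  haveI : NeZero (2 * p) := ⟨by have := hp.pos; omega⟩
  haveI : IsCyclic (ZMod (2 * p))ˣ := by
    rw [ZMod.isCyclic_units_two_mul_iff_of_odd _ (hp.odd_of_ne_two hp2)]
    exact ZMod.isCyclic_units_prime hp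
  obtain ⟨u₀, hu₀, hgen⟩ := exists_forall_units_eq_pow_or_eq_neg_pow_of_isCyclic (m := 2 * p)
  obtain ⟨q, hsq, hqN, h32, h8, h⟩ := exists_jacobiSym_represents_of_generator_mod_of_isNewform0 f (u := 2) (v := p)
    two_ne_zero (by rw [hN]; push_cast; ring) rfl hu₀ hgen hf (by rw [hN]; exact dvd_mul_right 4 p)
  rcases periodLatticeGamma1_eq_or_legendre_of_admissible f hp (a := 2) (by rw [hN]; norm_num) (by norm_num) hp2 hqN h32 h
    with hΛ | ⟨rfl, hJ⟩
  · exact Or.inl hΛ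
  · refine Or.inr ⟨h8 ?_, hJ⟩
    rw [hN]; intro h8d
    have hcop : Nat.Coprime 8 q := (Nat.coprime_primes Nat.prime_two hp |>.mpr (Ne.symm hp2)).pow_left 3
    have : 8 ∣ 4 := hcop.dvd_of_dvd_mul_right h8d
    omega

/-- **`N = 8p`, `p` an odd prime, `f` a newform: `Λ₁(f) = Λ₀(f)` or the `Γ₁(8p)`-periods are exactly the periods with `(p | |d_γ|) = +1`.**
(`u = 2`, `v = 2p`, `uv = 4p`.) [cite: LingOesterle1991, §1, Thm. 1 and Thm. 6] -/
theorem periodLatticeGamma1_eq_or_legendre_of_eight_mul_prime {p : ℕ} (hp : p.Prime) (hp2 : p ≠ 2) (hN : N = 8 * p)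
    (hf : IsNewform0 f) :
    periodLatticeGamma1 f = periodLattice f ∨
      ∀ γ : Gamma0 N, cuspSymbol f γ ∈ periodLatticeGamma1 f ↔ J(p | (((γ : SL(2, ℤ)) 1 1 : ℤ)).natAbs) = 1 := by
  haveI : IsCyclic (ZMod p)ˣ := ZMod.isCyclic_units_prime hp
  obtain ⟨u₀, hu₀, hgen⟩ := exists_forall_units_eq_pow_or_eq_neg_pow_four_mul (hp.odd_of_ne_two hp2)
  obtain ⟨q, hsq, hqN, h32, h8, h⟩ := exists_jacobiSym_represents_of_generator_mod_of_isNewform0 f (u := 2) (v := 2 * p)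
    two_ne_zero (by rw [hN]; push_cast; ring) (by ring) hu₀ hgen hf (by rw [hN]; exact ⟨2 * p, by ring⟩)
  rcases periodLatticeGamma1_eq_or_legendre_of_admissible f hp (a := 3) (by rw [hN]; norm_num) (by norm_num) hp2 hqN h32 h
    with hΛ | ⟨rfl, hJ⟩
  · exact Or.inl hΛ
  · exact Or.inr hJ

/-- **`N = 16p`, `p` an odd prime, `f` a newform: `Λ₁(f) = Λ₀(f)` or the `Γ₁(16p)`-periods are exactly the periods with `(p | |d_γ|) = +1`.**
(`u = 4`, `v = p`, `uv = 4p`.) [cite: LingOesterle1991, §1, Thm. 1 and Thm. 6] -/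
theorem periodLatticeGamma1_eq_or_legendre_of_sixteen_mul_prime {p : ℕ} (hp : p.Prime) (hp2 : p ≠ 2) (hN : N = 16 * p)
    (hf : IsNewform0 f) :
    periodLatticeGamma1 f = periodLattice f ∨
      ∀ γ : Gamma0 N, cuspSymbol f γ ∈ periodLatticeGamma1 f ↔ J(p | (((γ : SL(2, ℤ)) 1 1 : ℤ)).natAbs) = 1 := by
  haveI : IsCyclic (ZMod p)ˣ := ZMod.isCyclic_units_prime hp
  obtain ⟨u₀, hu₀, hgen⟩ := exists_forall_units_eq_pow_or_eq_neg_pow_four_mul (hp.odd_of_ne_two hp2)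
  obtain ⟨q, hsq, hqN, h32, h8, h⟩ := exists_jacobiSym_represents_of_generator_mod_of_isNewform0 f (u := 4) (v := p)
    (by norm_num) (by rw [hN]; push_cast; ring) (by ring) hu₀ hgen hf (by rw [hN]; exact ⟨4 * p, by ring⟩)
  rcases periodLatticeGamma1_eq_or_legendre_of_admissible f hp (a := 4) (by rw [hN]; norm_num) (by norm_num) hp2 hqN h32 h
    with hΛ | ⟨rfl, hJ⟩
  · exact Or.inl hΛ
  · exact Or.inr hJ

/-- **`N ∈ {32, 64, 128, 256}`, `f` a newform: `Λ₁(f) = Λ₀(f)` or the `Γ₁(N)`-periods are exactly the periods with `(2 | |d_γ|) = +1`,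
i.e. `d_γ ≡ ±1 (mod 8)`.**  (Units of `ℤ/8`, `ℤ/16` are `± 3^k`; admissible `q ∈ {1, 2}`.) [cite: LingOesterle1991, §1, Thm. 1 and Thm. 6] -/
theorem periodLatticeGamma1_eq_or_chi8_of_two_power (hN : N = 32 ∨ N = 64 ∨ N = 128 ∨ N = 256) (hf : IsNewform0 f) :
    periodLatticeGamma1 f = periodLattice f ∨
      ∀ γ : Gamma0 N, cuspSymbol f γ ∈ periodLatticeGamma1 f ↔ J(2 | (((γ : SL(2, ℤ)) 1 1 : ℤ)).natAbs) = 1 := by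
  have h3 : IsUnit (3 : ZMod 8) := by decide
  have h3' : IsUnit (3 : ZMod 16) := by decide
  -- a representing Kronecker symbol `q ∣ N`, `q` squarefree
  have key : ∃ e : ℕ, N = 2 ^ e ∧ ∃ q : ℕ, Squarefree q ∧ q ∣ N ∧
      ∀ γ : Gamma0 N, cuspSymbol f γ ∈ periodLatticeGamma1 f ↔ J(q | (((γ : SL(2, ℤ)) 1 1 : ℤ)).natAbs) = 1 := by
    rcases hN with rfl | rfl | rfl | rfl
    · obtain ⟨q, hsq, hqN, -, -, h⟩ := exists_jacobiSym_represents_of_generator_mod_of_isNewform0 f (u := 4) (v := 2)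
        (by norm_num) (by norm_num) (by norm_num) h3 forall_units_zmod_eight hf (by norm_num)
      exact ⟨5, by norm_num, q, hsq, hqN, h⟩
    · obtain ⟨q, hsq, hqN, -, -, h⟩ := exists_jacobiSym_represents_of_generator_mod_of_isNewform0 f (u := 8) (v := 1)
        (by norm_num) (by norm_num) (by norm_num) h3 forall_units_zmod_eight hf (by norm_num)
      exact ⟨6, by norm_num, q, hsq, hqN, h⟩
    · obtain ⟨q, hsq, hqN, -, -, h⟩ := exists_jacobiSym_represents_of_generator_mod_of_isNewform0 f (u := 8) (v := 2)
        (by norm_num) (by norm_num) (by norm_num) h3' forall_units_zmod_sixteen hf (by norm_num)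
      exact ⟨7, by norm_num, q, hsq, hqN, h⟩
    · obtain ⟨q, hsq, hqN, -, -, h⟩ := exists_jacobiSym_represents_of_generator_mod_of_isNewform0 f (u := 16) (v := 1)
        (by norm_num) (by norm_num) (by norm_num) h3' forall_units_zmod_sixteen hf (by norm_num)
      exact ⟨8, by norm_num, q, hsq, hqN, h⟩
  obtain ⟨e, hNe, q, hsq, hqN, h⟩ := key
  rcases eq_one_or_eq_two_of_squarefree_dvd_two_pow (hNe ▸ hqN) hsq with rfl | rfl
  · exact Or.inl (periodLatticeGamma1_eq_of_forall_jacobiSym_one f rfl h)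
  · exact Or.inr h

end Summit.BirchSwinnertonDyer.BirchSwinnertonDyer.Theorems.ManinLocalTwoThree

end
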